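import Literature.NumberTheory.Automorphic.UnitaryGroupAutomorphicRep     -- ★ `unitaryGroupOfForm`, `mem_unitaryGroupOfForm_iff`
import Mathlib.LinearAlgebra.Matrix.Notation
import Mathlib.LinearAlgebra.Matrix.Trace
import HarnessLib

/-!
# The quasi-split rank-one unitary group `U(J₂)(K)`, `J₂ = antidiag(1,1)`: unitarity in entries, Δ-identities, Borel ∕ scalar ∕ Weyl ∕ anti-diagonal members
(Rogawski 1990 §1.9–1.10, §3.1; Mok 2014 §1)

Topic `NumberTheory/Automorphic`; namespace `Literature.NumberTheory.Automorphic.UnitaryGroup`.  THEOREMS ONLY (no definition, no instance, no notation,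
no named fact, no `sorry`); FIELD-GENERIC (`K` a field, `σ : K →+* K`, an involution where stated).  Cell `pub/hodgecm-mathlib` (D-0151), crux H413 =
stmt-HodgeConjecture-24833, F0∕P3a road «D-N6-ns», floor-2 line «N6nsGerm», stub `stub_N6nsGlue` SATURATION HALF (LEAD F0P3a-plan (g9) WORD T8-55 →
B-p08 (g26)); this is the ALGEBRAIC half of census file F2, consumed by `UnitaryGroupRankOneCharpolySections.lean` (the openness of the class map).
HONEST LABEL: HC_CM is proved only modulo the 2 remaining named inputs (hLiu418, h413) until rung 0 closes; this file proves no letter.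

THE MATHEMATICS.  For `g = (a b; c d) ∈ GL₂(K)`, `Δ = det g`, unitarity `ᵗ(σg) J₂ g = J₂` for `J₂ = (0 1; 1 0)` is the four relations
`σc·a + σa·c = 0`, `σc·b + σa·d = 1`, `σd·a + σb·c = 1`, `σd·b + σb·d = 0` (§1), whence `σa·Δ = a`, `σb·Δ = −b`, `σc·Δ = −c`, `σd·Δ = d`, `σΔ·Δ = 1`,
`σ(tr g)·Δ = tr g` («`g⁻¹ = J₂ ᵗ(σg) J₂`»; the class `(tr g, det g)` is «admissible»).  §2 records explicit members with their inverse matrices: the Borel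
elements `b(λ, ν) = (λ λν; 0 (σλ)⁻¹)` (`σν = −ν`), the scalars `a·1` (`σa·a = 1`), the Weyl element `w = J₂`, the anti-diagonal REALISATION family
`g(t, r) = (0 (σr)⁻¹; r t)` (`σt·r + t·σr = 0`; class `(t, −r/σr)` — every admissible class is realised), the conjugation invariance of `(tr, det)`, and the
two entry computations `(w A w⁻¹)₁₀ = A₀₁`, `(u(ν₀) A u(ν₀)⁻¹)₀₁ = ν₀(A₁₁ − A₀₀)` (diagonal `A`) used to move a non-scalar point to one with `A₁₀ ≠ 0`.

## References
* [Rogawski1990] J. D. Rogawski, *Automorphic Representations of Unitary Groups in Three Variables*, Ann. of Math. Stud. 123 (1990): §1.9–1.10 pp. 8–9, §3.1 p. 19.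
* [Mok2014] C. P. Mok, *Endoscopic classification of representations of quasi-split unitary groups*, Mem. AMS 235 (2015), §1 Notation p. 5.
* [LanglandsShelstad1990Descent] R. P. Langlands, D. Shelstad, *Descent for transfer factors*, Progr. Math. 87 (1990), §2.2 p. 11.
-/

set_option autoImplicit false

noncomputable section

open Matrix
open scoped MatrixGroups

namespace Literature.NumberTheory.Automorphic.UnitaryGroup

open Literature.NumberTheory.Automorphic

/-! ## §1 Unitarity for `J₂ = antidiag(1,1)` in entries, and its consequences -/

section Entries

variable {K : Type*} [Field K] (σ : K →+* K)

/-- The `(i, j)` entry of `ᵗ(σg) · J₂ · g` for `J₂ = antidiag(1, 1)`: `σ(g₁ᵢ) g₀ⱼ + σ(g₀ᵢ) g₁ⱼ`. [cite: Mok2014, §1 Notation p. 5] -/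
theorem transpose_map_mul_antidiag_mul_apply (g : Matrix (Fin 2) (Fin 2) K) (i j : Fin 2) :
    ((g.map σ)ᵀ * !![(0 : K), 1; 1, 0] * g) i j = σ (g 1 i) * g 0 j + σ (g 0 i) * g 1 j := by
  simp only [Matrix.mul_apply, Fin.sum_univ_two, Matrix.transpose_apply, Matrix.map_apply, Matrix.of_apply, Matrix.cons_val',
    Matrix.cons_val_zero, Matrix.cons_val_one, Matrix.empty_val', Matrix.cons_val_fin_one]
  ring

/-- **Membership in `U(J₂)(K)` in entries**: `g = (a b; c d)` is `J₂`-unitary iff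
`σc·a + σa·c = 0`, `σc·b + σa·d = 1`, `σd·a + σb·c = 1`, `σd·b + σb·d = 0`. [cite: Mok2014, §1 Notation p. 5] [cite: Rogawski1990, §1.9 p. 8] -/
theorem mem_unitaryGroupOfForm_antidiag_iff (g : GL (Fin 2) K) :
    g ∈ unitaryGroupOfForm σ !![(0 : K), 1; 1, 0] ↔
      σ (g.val 1 0) * g.val 0 0 + σ (g.val 0 0) * g.val 1 0 = 0 ∧ σ (g.val 1 0) * g.val 0 1 + σ (g.val 0 0) * g.val 1 1 = 1 ∧
        σ (g.val 1 1) * g.val 0 0 + σ (g.val 0 1) * g.val 1 0 = 1 ∧ σ (g.val 1 1) * g.val 0 1 + σ (g.val 0 1) * g.val 1 1 = 0 := by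
  rw [mem_unitaryGroupOfForm_iff]
  constructor
  · intro h
    have h00 := congr_fun (congr_fun h 0) 0
    have h01 := congr_fun (congr_fun h 0) 1
    have h10 := congr_fun (congr_fun h 1) 0
    have h11 := congr_fun (congr_fun h 1) 1
    rw [transpose_map_mul_antidiag_mul_apply] at h00 h01 h10 h11
    simp only [Matrix.of_apply, Matrix.cons_val', Matrix.cons_val_zero, Matrix.cons_val_one, Matrix.empty_val',
      Matrix.cons_val_fin_one] at h00 h01 h10 h11
    exact ⟨h00, h01, h10, h11⟩
  · rintro ⟨h00, h01, h10, h11⟩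
    ext i j
    rw [transpose_map_mul_antidiag_mul_apply]
    fin_cases i <;> fin_cases j <;>
      simp only [Matrix.of_apply, Matrix.cons_val', Matrix.cons_val_zero, Matrix.cons_val_one, Matrix.empty_val',
        Matrix.cons_val_fin_one, Fin.zero_eta, Fin.mk_one] <;> assumption

variable {σ}

/-- **The four Δ-identities of a `J₂`-unitary `g = (a b; c d)`, `Δ = det g`**: `σa·Δ = a`, `σb·Δ = −b`, `σc·Δ = −c`, `σd·Δ = d` (ring consequences of
the four unitarity relations; they say `g⁻¹ = J₂ ᵗ(σg) J₂`). [cite: Rogawski1990, §3.1 p. 19] -/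
theorem sigma_entries_mul_det_of_mem {g : GL (Fin 2) K} (hg : g ∈ unitaryGroupOfForm σ !![(0 : K), 1; 1, 0]) :
    σ (g.val 0 0) * g.val.det = g.val 0 0 ∧ σ (g.val 0 1) * g.val.det = -g.val 0 1 ∧
      σ (g.val 1 0) * g.val.det = -g.val 1 0 ∧ σ (g.val 1 1) * g.val.det = g.val 1 1 := by
  obtain ⟨h1, h2, h3, h4⟩ := (mem_unitaryGroupOfForm_antidiag_iff σ g).1 hg
  rw [Matrix.det_fin_two]
  refine ⟨?_, ?_, ?_, ?_⟩
  · linear_combination (g.val 0 0) * h2 - (g.val 0 1) * h1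
  · linear_combination (-(g.val 0 1)) * h3 + (g.val 0 0) * h4
  · linear_combination (-(g.val 1 0)) * h2 + (g.val 1 1) * h1
  · linear_combination (g.val 1 1) * h3 - (g.val 1 0) * h4

/-- **`σ(det g) · det g = 1`** for `g ∈ U(J₂)(K)`. [cite: Rogawski1990, §3.1 p. 19] -/
theorem sigma_det_mul_det_of_mem {g : GL (Fin 2) K} (hg : g ∈ unitaryGroupOfForm σ !![(0 : K), 1; 1, 0]) :
    σ g.val.det * g.val.det = 1 := by
  have h := congr_arg Matrix.det ((mem_unitaryGroupOfForm_iff).1 hg)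
  have hσdet : (g.val.map σ).det = σ g.val.det := by
    rw [← RingHom.mapMatrix_apply, ← RingHom.map_det]
  rw [Matrix.det_mul, Matrix.det_mul, Matrix.det_transpose, hσdet, Matrix.det_fin_two_of] at h
  -- `det J₂ = -1`
  have hJ : (0 : K) * 0 - 1 * 1 = -1 := by ring
  rw [hJ] at h
  linear_combination -h

/-- **`σ(tr g) · det g = tr g`** for `g ∈ U(J₂)(K)` (the class `(tr g, det g)` of a unitary element is «admissible»). [cite: Rogawski1990, §3.1 p. 19] -/
theorem sigma_trace_mul_det_of_mem {g : GL (Fin 2) K} (hg : g ∈ unitaryGroupOfForm σ !![(0 : K), 1; 1, 0]) :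
    σ g.val.trace * g.val.det = g.val.trace := by
  obtain ⟨ha, -, -, hd⟩ := sigma_entries_mul_det_of_mem hg
  rw [Matrix.trace_fin_two, map_add, add_mul, ha, hd]

/-- The determinant of a unitary element is non-zero. [cite: Rogawski1990, §3.1 p. 19] -/
theorem det_ne_zero_of_mem {g : GL (Fin 2) K} (hg : g ∈ unitaryGroupOfForm σ !![(0 : K), 1; 1, 0]) : g.val.det ≠ 0 := by
  intro h
  have := sigma_det_mul_det_of_mem hg
  rw [h, mul_zero] at this
  exact zero_ne_one this

end Entries

/-! ## §2 Members: Borel elements `b(λ, ν)`, scalars, the Weyl element `w = J₂`, the anti-diagonal realisation family -/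

section Members

variable {K : Type*} [Field K] {σ : K →+* K}

/-- The Borel matrices `(λ λν; 0 (σλ)⁻¹)` and `(λ⁻¹ −ν·σλ; 0 σλ)` multiply to `1` (both orders) when `λ ≠ 0` (and `σ` is an involution).
[cite: Rogawski1990, §1.10 p. 9] -/
theorem borel_mul_borelInv_eq_one (hσ : ∀ x, σ (σ x) = x) {lam : K} (nu : K) (hlam : lam ≠ 0) :
    !![lam, lam * nu; 0, (σ lam)⁻¹] * !![lam⁻¹, -(nu * σ lam); 0, σ lam] = 1 ∧
      !![lam⁻¹, -(nu * σ lam); 0, σ lam] * !![lam, lam * nu; 0, (σ lam)⁻¹] = 1 := by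
  have hσlam : σ lam ≠ 0 := fun h => hlam (by rw [← hσ lam, h, map_zero])
  constructor <;>
  · ext i j
    fin_cases i <;> fin_cases j <;> simp [Matrix.mul_apply, Fin.sum_univ_two, hlam, hσlam] <;> ring

/-- **The Borel element `b(λ, ν) = (λ λν; 0 (σλ)⁻¹)`** (`λ ≠ 0`, inverse `(λ⁻¹ −ν·σλ; 0 σλ)`) is `J₂`-unitary when `σν = −ν` (and only then).
[cite: Rogawski1990, §1.10 p. 9] -/
theorem borel_mem_unitaryGroupOfForm_antidiag (hσ : ∀ x, σ (σ x) = x) {lam nu : K} (hlam : lam ≠ 0) (hnu : σ nu = -nu)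
    (h1 : !![lam, lam * nu; 0, (σ lam)⁻¹] * !![lam⁻¹, -(nu * σ lam); 0, σ lam] = 1)
    (h2 : !![lam⁻¹, -(nu * σ lam); 0, σ lam] * !![lam, lam * nu; 0, (σ lam)⁻¹] = 1) :
    (⟨!![lam, lam * nu; 0, (σ lam)⁻¹], !![lam⁻¹, -(nu * σ lam); 0, σ lam], h1, h2⟩ : GL (Fin 2) K) ∈
      unitaryGroupOfForm σ !![(0 : K), 1; 1, 0] := by
  have hσlam : σ lam ≠ 0 := fun h => hlam (by rw [← hσ lam, h, map_zero])
  rw [mem_unitaryGroupOfForm_iff]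
  ext i j
  rw [transpose_map_mul_antidiag_mul_apply]
  fin_cases i <;> fin_cases j <;> simp [map_inv₀, hσ, hnu, hlam, hσlam]
  -- the `(1,1)` relation: `ν + σν = 0`
  linear_combination (-nu) * mul_inv_cancel₀ hσlam

/-- The scalar matrices `(a 0; 0 a)`, `(a⁻¹ 0; 0 a⁻¹)` multiply to `1` when `a ≠ 0`. [cite: Mok2014, §1 Notation p. 5] -/
theorem scalar_mul_scalarInv_eq_one {a : K} (ha : a ≠ 0) :
    !![a, 0; 0, a] * !![a⁻¹, 0; 0, a⁻¹] = 1 ∧ !![a⁻¹, 0; 0, a⁻¹] * !![a, 0; 0, a] = 1 := by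
  constructor <;>
  · ext i j
    fin_cases i <;> fin_cases j <;> simp [Matrix.mul_apply, Fin.sum_univ_two, ha]

/-- **The scalar `a·1` is `J₂`-unitary when `σa·a = 1`**, as the explicit `GL` element `(a 0; 0 a)`. [cite: Mok2014, §1 Notation p. 5] -/
theorem scalar_mem_unitaryGroupOfForm_antidiag {a : K} (ha : σ a * a = 1) (h1 : !![a, 0; 0, a] * !![a⁻¹, 0; 0, a⁻¹] = 1)
    (h2 : !![a⁻¹, 0; 0, a⁻¹] * !![a, 0; 0, a] = 1) :
    (⟨!![a, 0; 0, a], !![a⁻¹, 0; 0, a⁻¹], h1, h2⟩ : GL (Fin 2) K) ∈ unitaryGroupOfForm σ !![(0 : K), 1; 1, 0] := by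
  rw [mem_unitaryGroupOfForm_iff]
  ext i j
  rw [transpose_map_mul_antidiag_mul_apply]
  fin_cases i <;> fin_cases j <;> simp [ha]

/-- `w · w = 1` for `w = (0 1; 1 0)`. [cite: Rogawski1990, §1.10 p. 9] -/
theorem weylAntidiag_mul_self : !![(0 : K), 1; 1, 0] * !![(0 : K), 1; 1, 0] = 1 := by
  ext i j
  fin_cases i <;> fin_cases j <;> simp [Matrix.mul_apply, Fin.sum_univ_two]

/-- **The Weyl element `w = J₂ = (0 1; 1 0)` is `J₂`-unitary** (`w = w⁻¹`). [cite: Rogawski1990, §1.10 p. 9] -/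
theorem weyl_mem_unitaryGroupOfForm_antidiag (h1 : !![(0 : K), 1; 1, 0] * !![(0 : K), 1; 1, 0] = 1) :
    (⟨!![(0 : K), 1; 1, 0], !![(0 : K), 1; 1, 0], h1, h1⟩ : GL (Fin 2) K) ∈ unitaryGroupOfForm σ !![(0 : K), 1; 1, 0] := by
  rw [mem_unitaryGroupOfForm_iff]
  ext i j
  rw [transpose_map_mul_antidiag_mul_apply]
  fin_cases i <;> fin_cases j <;> simp

/-- The anti-diagonal family's matrices `(0 (σr)⁻¹; r t)` and `(t·σr r⁻¹; σr 0)` multiply to `1` (both orders) when `r ≠ 0` and `σt·r + t·σr = 0`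
(`σ` an involution). [cite: LanglandsShelstad1990Descent, §2.2 p. 11] -/
theorem antidiagFamily_mul_inv_eq_one (hσ : ∀ x, σ (σ x) = x) {t r : K} (hr : r ≠ 0) (ht : σ t * r + t * σ r = 0) :
    !![0, (σ r)⁻¹; r, t] * !![σ t, r⁻¹; σ r, 0] = 1 ∧ !![σ t, r⁻¹; σ r, 0] * !![0, (σ r)⁻¹; r, t] = 1 := by
  have hσr : σ r ≠ 0 := fun h => hr (by rw [← hσ r, h, map_zero])
  constructor
  · ext i j
    fin_cases i <;> fin_cases j <;> simp [Matrix.mul_apply, Fin.sum_univ_two, hr, hσr]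
    -- the `(1,0)` entry: `r σt + t σr = 0`
    linear_combination ht
  · ext i j
    fin_cases i <;> fin_cases j <;> simp [Matrix.mul_apply, Fin.sum_univ_two, hr, hσr]
    -- the `(0,1)` entry: `σt (σr)⁻¹ + r⁻¹ t = 0`
    field_simp
    linear_combination ht

/-- **THE ANTI-DIAGONAL REALISATION FAMILY**: `g(t, r) = (0 (σr)⁻¹; r t)` (`r ≠ 0`, inverse `(σt r⁻¹; σr 0)`) is `J₂`-unitary when
`σt·r + t·σr = 0`; its class is `(tr, det) = (t, −r/σr)` (`trace_fin_two`∕`det_fin_two`).  With `r = 1 − Δ′` (`Δ′ ≠ 1`) or `r = ν₀(1 + Δ′)` (`Δ′ ≠ −1`,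
`σν₀ = −ν₀`) it realises EVERY admissible class `(t, Δ′)`. [cite: LanglandsShelstad1990Descent, §2.2 p. 11] [cite: Rogawski1990, §3.1 p. 19] -/
theorem antidiagFamily_mem_unitaryGroupOfForm_antidiag (hσ : ∀ x, σ (σ x) = x) {t r : K} (hr : r ≠ 0) (ht : σ t * r + t * σ r = 0)
    (h1 : !![0, (σ r)⁻¹; r, t] * !![σ t, r⁻¹; σ r, 0] = 1) (h2 : !![σ t, r⁻¹; σ r, 0] * !![0, (σ r)⁻¹; r, t] = 1) :
    (⟨!![0, (σ r)⁻¹; r, t], !![σ t, r⁻¹; σ r, 0], h1, h2⟩ : GL (Fin 2) K) ∈ unitaryGroupOfForm σ !![(0 : K), 1; 1, 0] := by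
  have hσr : σ r ≠ 0 := fun h => hr (by rw [← hσ r, h, map_zero])
  rw [mem_unitaryGroupOfForm_iff]
  ext i j
  rw [transpose_map_mul_antidiag_mul_apply]
  fin_cases i <;> fin_cases j <;> simp [map_inv₀, hσ, hr, hσr]
  -- the `(1,1)` relation: `σt (σr)⁻¹ + σ((σr)⁻¹) t = 0`
  field_simp
  linear_combination ht

/-- The Weyl element as an element of `U(J₂)(K)` with prescribed matrix and inverse matrix. [cite: Rogawski1990, §1.10 p. 9] -/
theorem exists_weyl_elt : ∃ x : ↥(unitaryGroupOfForm σ !![(0 : K), 1; 1, 0]), (x : GL (Fin 2) K).val = !![(0 : K), 1; 1, 0] ∧ ((x : GL (Fin 2) K)⁻¹).val = !![(0 : K), 1; 1, 0] :=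
  ⟨⟨⟨_, _, weylAntidiag_mul_self, weylAntidiag_mul_self⟩, weyl_mem_unitaryGroupOfForm_antidiag weylAntidiag_mul_self⟩, rfl, rfl⟩

/-- The unipotent `u(ν₀) = (1 ν₀; 0 1)` (`σν₀ = −ν₀`) as an element of `U(J₂)(K)` with prescribed matrix and inverse. [cite: Rogawski1990, §1.10 p. 9] -/
theorem exists_unipotent_elt (hσ : ∀ x, σ (σ x) = x) {ν₀ : K} (hν₀ : σ ν₀ = -ν₀) :
    ∃ x : ↥(unitaryGroupOfForm σ !![(0 : K), 1; 1, 0]), (x : GL (Fin 2) K).val = !![(1 : K), ν₀; 0, 1] ∧ ((x : GL (Fin 2) K)⁻¹).val = !![(1 : K), -ν₀; 0, 1] := by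
  obtain ⟨h1, h2⟩ := borel_mul_borelInv_eq_one hσ ν₀ (one_ne_zero (α := K))
  have hmem := borel_mem_unitaryGroupOfForm_antidiag hσ one_ne_zero hν₀ h1 h2
  refine ⟨⟨⟨_, _, h1, h2⟩, hmem⟩, ?_, ?_⟩
  · show !![(1 : K), 1 * ν₀; 0, (σ 1)⁻¹] = _
    rw [map_one, inv_one, one_mul]
  · show !![(1 : K)⁻¹, -(ν₀ * σ 1); 0, σ 1] = _
    rw [map_one, inv_one, mul_one]

/-- `tr` and `det` are invariant under conjugation inside `U(J₂)(K)`. [cite: Rogawski1990, §3.1 p. 19] -/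
theorem trace_det_conj_eq (u y : ↥(unitaryGroupOfForm σ !![(0 : K), 1; 1, 0])) :
    (↑(y * u * y⁻¹) : GL (Fin 2) K).val.trace = (u : GL (Fin 2) K).val.trace ∧
      (↑(y * u * y⁻¹) : GL (Fin 2) K).val.det = (u : GL (Fin 2) K).val.det := by
  constructor
  · show ((y : GL (Fin 2) K).val * (u : GL (Fin 2) K).val * ((y : GL (Fin 2) K)⁻¹).val).trace = _
    exact Matrix.trace_units_conj _ _
  · show ((y : GL (Fin 2) K).val * (u : GL (Fin 2) K).val * ((y : GL (Fin 2) K)⁻¹).val).det = _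
    exact Matrix.det_units_conj _ _

/-- Conjugation by the Weyl element `w = J₂` moves the `(0,1)` entry to the `(1,0)` slot: `(w A w⁻¹)₁₀ = A₀₁`. [cite: Rogawski1990, §1.10 p. 9] -/
theorem conj_entry_one_zero_of_val_eq_weyl (x A : ↥(unitaryGroupOfForm σ !![(0 : K), 1; 1, 0])) (hx : (x : GL (Fin 2) K).val = !![(0 : K), 1; 1, 0])
    (hx' : ((x : GL (Fin 2) K)⁻¹).val = !![(0 : K), 1; 1, 0]) :
    (↑(x * A * x⁻¹) : GL (Fin 2) K).val 1 0 = (A : GL (Fin 2) K).val 0 1 := by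
  show ((x : GL (Fin 2) K).val * (A : GL (Fin 2) K).val * ((x : GL (Fin 2) K)⁻¹).val) 1 0 = _
  rw [hx, hx', Matrix.eta_fin_two (A : GL (Fin 2) K).val, Matrix.mul_fin_two, Matrix.mul_fin_two]
  simp only [Matrix.of_apply, Matrix.cons_val', Matrix.cons_val_zero, Matrix.cons_val_one, Matrix.empty_val', Matrix.cons_val_fin_one]
  ring

/-- Conjugating a DIAGONAL element by the unipotent `u(ν₀) = (1 ν₀; 0 1)` produces the `(0,1)` entry `ν₀ (A₁₁ − A₀₀)`. [cite: Rogawski1990, §1.10 p. 9] -/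
theorem conj_entry_zero_one_of_val_eq_unipotent {ν₀ : K} (x A : ↥(unitaryGroupOfForm σ !![(0 : K), 1; 1, 0])) (hx : (x : GL (Fin 2) K).val = !![(1 : K), ν₀; 0, 1])
    (hx' : ((x : GL (Fin 2) K)⁻¹).val = !![(1 : K), -ν₀; 0, 1]) (hb : (A : GL (Fin 2) K).val 0 1 = 0) (hc : (A : GL (Fin 2) K).val 1 0 = 0) :
    (↑(x * A * x⁻¹) : GL (Fin 2) K).val 0 1 = ν₀ * ((A : GL (Fin 2) K).val 1 1 - (A : GL (Fin 2) K).val 0 0) := by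
  show ((x : GL (Fin 2) K).val * (A : GL (Fin 2) K).val * ((x : GL (Fin 2) K)⁻¹).val) 0 1 = _
  rw [hx, hx', Matrix.eta_fin_two (A : GL (Fin 2) K).val, hb, hc, Matrix.mul_fin_two, Matrix.mul_fin_two]
  simp only [Matrix.of_apply, Matrix.cons_val', Matrix.cons_val_zero, Matrix.cons_val_one, Matrix.empty_val', Matrix.cons_val_fin_one]
  ring

end Members

end Literature.NumberTheory.Automorphic.UnitaryGroup

end
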